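import Mathlib
import HarnessLib
import HarnessLib.Audit
import Summits.Parity.Statement
import HarnessLib.Audit.Status.Attr

/-!
Route: LeeYangFibres

DORMANT since 2026-08-24T18:42:15Z (reconciler: no traction for 7 d (last activity item-evidence-added at 2026-08-17T18:32:04Z); parked, not closed — `ledger route dormant route-Parity-LeeYangFibres --off` to reactivate) — unstaffed, not closed; items shared with open routes are served there. `ledger route dormant <id> --off` reactivates.

# Route LeeYangFibres — one fugacity per form — fibre-wise real zeros of the joint rough-cell
polynomial ALONG A SLOWLY DIVERGENT DEGREE kill every parity character of a prime tuple to absolute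
accuracy (GHL via the proved quantitative clipping)

It suffices to show X = CellParityLawSaving ∧ FibreHyperbolicityAlong — the route's two mechanism
cruxes in the u-UNIFORM,
RATE-BEARING form that the absolute error εN of the Statement demands (2026-08-17 route-repair of
the hides-summit finding; conforming
gen-2 re-route of card lee-yang-circle-prime-factors). Objects: a one-dimensional Green–Tao system Ψ
= (ψ_1,…,ψ_t) (size ≤ L, convex
K ⊆ [−N,N]), the ROUGHNESS SCHEDULE u = U(N) := max 4 ⌊√(log log N)/2⌋, and the JOINT ROUGH CELLS
C_j = #{n ∈ K∩ℤ∩[−N,N] : P⁻(ψ_i(n)) > N^{1/u} and Ω(ψ_i(n)) = j_i for every i}, j ∈ [1,u]^t — a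
partition function with ONE FUGACITY
z_i PER FORM, R(z) = Σ_j C_j z^j; model cells A_j(N) = #{m ≤ N : P⁻(m) > N^{1/u}, Ω(m) = j}, main
term M_j = β_∞(Ψ,K)·∏_pβ_p(Ψ)·∏_i A_{j_i}(N)/N
(tree: archFactor, singularProduct). CellParityLawSaving (crux 3, the multi-character Bombieri law
with a log-power saving): for some
δ = δ(t,L) > 0, C_j = Θ(parity vector of j)·M_j + O(N/(log N)^{t+δ}) at u = U(N), uniformly in Ψ, K
and j, where
Θ = Σ_{S⊆[t]} θ_S·∏_{i∈S}(−1)^{j_i+1}, θ_∅ = 1, |θ_S| ≤ 2 — the 2^t − 1 amplitudes θ_S(N,Ψ,K) are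
exactly the sign-pattern ghosts the
sieve cannot see. FibreHyperbolicityAlong (crux 2, the card's H(u) with one fugacity per form, along
the schedule): whenever K carries
singular mass β_∞∏β_p ≥ ηN, every FIBRE of R at u = U(N) — fugacity z_i free, the other fugacities
frozen at real w_k ∈ (0,1] — has only
real zeros, for all N ≥ N₀(t,L,η). Read through the MODEL PENCIL F_u(ζ) + θF_u(−ζ) of the
Buchstab–Dickman row, full real-rootedness
of a fibre clips its odd Walsh amplitude below the pencil's real-rootedness threshold, which decays
faster than every power of u
(MarginPoly — PROVED, from the mod-Gamma disc asymptotic F_u(z) ≈ e^{−γz}(u−1)^z/Γ(1+z), also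
PROVED); along u = U(N) that beats the
residual factor sup_Ψ∏_pβ_p ≍ (log log N)^{t−1} ≤ (2U+2)^{2t−2}, so the prime cell j = (1,…,1) comes
out with ABSOLUTE error εN/log^t N
and partial summation gives DimOne (the d = 1 Statement, Conj. 1.2 shape) — the whole chain
CellParityLawSaving → FibreHyperbolicityAlong
→ DimOne is ONE KERNEL-CHECKED THEOREM
(`Cruxes.AbsoluteUpgrade.DipMarginRateExchange.dimOne_of_dipInputs`, p114853, 26 files of the
dip-margin-rate-exchange line; support item QuantitativeClipping), and DimOne →
GeneralizedHardyLittlewood is the PROVED fibration lemma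
(stmt-Parity-0822, `Theorems.leeYangFibres_fibrationLemma`). The fixed-degree forms of the two
cruxes (FibreHyperbolicity: cofinal in
u; CellParityLaw: every fixed u, error εN/log^t N) stay filed as the route's FIRST MILESTONES:
through the proved fixed-degree clipping
(HyperbolicityClipsParity, ModelCellFacts, CellsToRelativeDimOne) they give the relative output
RelativeDimOne (Green–Tao Conj. 1.4
shape at d = 1: twins, Sophie Germain, Goldbach-in-the-shift to relative o(1)) — but NOT the
Statement: the former complementary crux
AbsoluteUpgrade := RelativeDimOne → DimOne is kernel-checked equivalent to DimOne ∨ ¬RelativeDimOne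
(p121721), ten lead seats and a
strategist census (Cruxes/AbsoluteUpgrade/STRATEGY-CENSUS.md) found every skeleton of it R-inert
with a summit-strength residual, and it is
retired from `closes` (kept as a support: a corollary of the two rate cruxes,
`absoluteUpgrade_of_dipInputs`, and of the target).
Lean: `CellParityLawSaving ∧ FibreHyperbolicityAlong`

## Assembly
DECIDING THEOREM `closes` (glue.lean, sorry-free, pure logic; re-cut 2026-08-17):
`closes (hL : CellParityLawSaving) (hH : FibreHyperbolicityAlong) (hQ : QuantitativeClipping) (hF :
FibrationLemma) :
GeneralizedHardyLittlewood := hF (hQ hL hH)`. Hypotheses = the two ranked cruxes + two ROUTINE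
supports that are already theorems of
the tree: QuantitativeClipping := CellParityLawSaving → FibreHyperbolicityAlong → DimOne (its
statements are DEFINITIONALLY the dip
line's `DipMarginRateExchange.CellParityLawSaving/FibreHyperbolicityAlong` — `Iff.rfl`, planner
Sketch.lean rc 0 — so
`theorem quantitativeClipping_proof : QuantitativeClipping := fun hL hH =>
Cruxes.AbsoluteUpgrade.DipMarginRateExchange.dimOne_of_dipInputs hL hH`
closes it in one line; the proving module imports this Theses file, hence a hypothesis and not an
import) and FibrationLemma := DimOne →
GeneralizedHardyLittlewood (stmt-Parity-0822, PROVED 2026-08-16; admissible by class). No module is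
imported beyond the gate minimum; the
new cruxes are stated over the Statement module's vocabulary only (latticeBox, realPoint,
archFactor, singularProduct, Nat.minFac,
ArithmeticFunction.cardFactors; the schedule inlined as `max 4 ⌊Real.sqrt (Real.log (Real.log N)) /
2⌋₊`), so no unproved named fact
enters the cone. OFF THE CONE of `closes` (deliberately kept, none dropped — forty-odd Theorems
files cite these decls by name): the
fixed-degree cruxes FibreHyperbolicity (stmt-Parity-14108) and CellParityLaw (14109), the proved
model crux ModelHyperbolicity (14110),
the relative-milestone nodes PrimeCellsRelative (14112) / RelativeDimOne (14113, also wanted by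
VarianceWitness), the support
AbsoluteUpgrade (14116, also wanted by VarianceWitness), the proved fixed-degree glue ModelCellFacts
/ HyperbolicityClipsParity /
CellsToRelativeDimOne, and the proved item `Assembly` (stmt-Parity-14612, the rev-2 frame
CellParityLaw → FibreHyperbolicity →
AbsoluteUpgrade → GeneralizedHardyLittlewood, `leeYangFibres_assembly`), which stays the route's
single assembly-kind item; the
deciding theorem is `closes`.

Rationale: WHY THIS LINE. Mechanism (card lee-yang-circle-prime-factors C2 + absorbed card
log-concavity-kills-parity): use the ZERO LOCUS of the cell partition
function, not its values, as the non-Type-I input — hyperbolicity is preserved by rich operator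
classes and proved by interlacing
(LeeYang1952, HeilmannLieb1972, BorceaBranden2009, BorceaBrandenLiggett2007, Wagner2011,
arXiv:1210.3231), while every parity ghost is
maximally non-hyperbolic (θ_{12} = ±1 turns the w → 0 fibre F(z) ∓ F(−z) into an even/odd polynomial
with zeros on iℝ).
New versus gen-1 (one shifted prime, univariate, assembly = PairsHL): ONE FUGACITY PER FORM — the
t-variate cell polynomial of an
arbitrary d = 1 system, whose fibres interpolate between "the other forms prime" (w → 0) and "the
other forms merely rough" (w = 1); the
multi-character law (Walsh expansion over parity vectors; coordinatewise Bombieri,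
BombieriAsymptoticSieve1976 / FriedlanderIwaniecPisa1978,
by induction on t, here on Ω-cells); and a clipping lemma in which the frozen fugacities supply the
interpolation nodes. BUDGET (settled
2026-08-16/17, kernel-checked): fixed-degree hyperbolicity pins the Walsh amplitudes only to
RELATIVE accuracy b(u), whereas the Statement's
error εN is absolute and sup_Ψ ∏_pβ_p ≍ (e^γ log log N)^{t−1} (p86331, sharp p90245); the
complementary statement RelativeDimOne → DimOne
is DimOne ∨ ¬RelativeDimOne (p121721) and has no mechanism here or anywhere
(Cruxes/AbsoluteUpgrade/STRATEGY-CENSUS.md: T1–T5, S1–S7,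
D1–D6, N1–N3; three dead lines). So since 2026-08-17 the route runs the mechanism ALONG THE SCHEDULE
u = U(N) = max 4 ⌊√(log log N)/2⌋:
the real-rootedness threshold of the Buchstab–Dickman pencil decays faster than every power of u
(MarginPoly, PROVED by the c1 lead from
the mod-Gamma disc asymptotic of the row, Greaves2001 §4.2 adjoint method, de Bruijn/Alladi Laplace
analysis, and an explicit pencil zero
with a Rouché clearance circle), (log log N)^{t−1} ≤ (2U+2)^{2t−2} is a fixed power of U, and the
quantitative clipping
CellParityLawSaving → FibreHyperbolicityAlong → DimOne is a theorem of the tree (p114853). Imported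
areas: statistical mechanics of zeros
(dictionary: spins 1_{q|ψ_i(n)}, fugacity z_i per form, Fisher zeros from 1/Γ —
KowalskiNikeghbali2010,
whose mod-Poisson limit 1/Γ(1+z) is literally the MarginPoly input), geometry of polynomials
(Newton, Hermite–Biehler pencils, multiaffine interpolation),
the asymptotic sieve, anatomy of rough integers (Buchstab/Alladi; tree: RoughNumbersBuchstab.lean,
BuchstabFunction.lean, PNT with
de la Vallée Poussin rate). No other open Parity route uses a zero-locus hypothesis on Ω-cells
(HyperbolicConstellations: rank polynomial;
PrimeDeterminantCells: values of determinant cells).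

RANKED CRUXES. #0 DimOne (target) — the d = 1 case of GeneralizedHardyLittlewood
(Dickson–Hardy–Littlewood, Λ-weighted, uniform over non-degenerate systems of size ≤ L and convex K
⊆ [−N,N]) — VERBATIM DicksonFibration.DimOne (shared item stmt-Parity-0819); reached here as
QuantitativeClipping applied to the two rate cruxes, exactly as `closes hL hH hQ hF := hF (hQ hL
hH)` composes it. (why it might fail: = uniform Dickson/HL incl. twins, Sophie Germain, Goldbach in
the shift; Siegel-sensitive as typed (MatomakiMerikoski2023 Thm 1.3); parity blocks sieves; GTZ
vacuous at d = 1.) [GreenTao2010, MatomakiMerikoski2023, GoldstonSuriajaya2021, HardyLittlewood1923]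
#2 FibreHyperbolicityAlong (crux, LOAD-BEARING; added 2026-08-17) — (fibre hyperbolicity ALONG THE
SCHEDULE, the u-uniform clause of the card's H(u)) for all t ≥ 1, L and η > 0 there is N₀ such that
for N ≥ N₀, every non-degenerate d = 1 system Ψ of t forms with ‖Ψ‖_N ≤ L, every convex K ⊆ [−N,N]
with archFactor Ψ K · singularProduct Ψ ≥ ηN, every coordinate i and every frozen fugacity vector w
∈ (0,1]^t: the fibre polynomial ζ ↦ Σ_{j∈[1,U(N)]^t} C_j(Ψ,K,N,U(N)) ζ^{j_i} ∏_{k≠i} w_k^{j_k} has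
only real zeros, U(N) = max 4 ⌊√(log log N)/2⌋ — DEFINITIONALLY the dip line's
`DipMarginRateExchange.FibreHyperbolicityAlong` (the type of its guarded stub with the inert guard
removed; disprover-vetted: mass floor, convexity, w_k > 0 load-bearing, p113523; kit j018789:
144/144 fibres real-rooted at N = 10⁸). Neither the fixed-degree crux (cofinal ∃u) nor this diagonal
form implies the other. [difficulty: open-problem] (why it might fail: HL-strength parity content;
along U(N) the cells must track the tilted model row to relative accuracy ≪ U^{-U} (the pencil's
robustness radius), U = 4 for every N < exp(exp(100)); unguarded, so false under unbounded Siegel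
zeros; hides 'some rough t-tuple in every K of mass ≥ ηN'.) [LeeYang1952, HeilmannLieb1972,
BorceaBranden2009, Wagner2011, KowalskiNikeghbali2010, MatomakiMerikoski2023,
Summits/Parity/GeneralizedHardyLittlewood/Theorems/LeeYangFibresAbsoluteUpgradeDipDefs.lean,
Summits/Parity/GeneralizedHardyLittlewood/Theorems/AbsoluteUpgrade/Negative/FibreHyperbolicityAlongLoadBearing.lean,
Literature.Barriers.Parity.SelbergParityBarrier]
#2 FibreHyperbolicity (crux, FIXED-DEGREE SHADOW of the above; the original rank-2 item
stmt-Parity-14108, off the cone of `closes` since the 2026-08-17 re-cut, kept as the first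
milestone: with CellParityLaw it yields RelativeDimOne) — for all t ≥ 1, L, u₀ and η > 0 there are u
≥ max(u₀,2) and N₀ such that for N ≥ N₀ … every fibre of the joint rough-cell polynomial at
roughness u of every admissible (Ψ,K) of mass ≥ ηN has only real zeros (cofinal in u). [difficulty:
open-problem] (why it might fail: Given the law it is HL-strength parity content with almost no
slack (gen-1 calibration θ*(6)≈0.02, kit j000121) and no sieve proof; ghosts θ_S=±1 put fibre zeros
on iℝ; shift-uniform, so false under a Siegel zero; noisy top cells at finite N.) [LeeYang1952,
HeilmannLieb1972, BorceaBranden2009, BorceaBrandenLiggett2007, Wagner2011, arXiv:1210.3231,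
MatomakiMerikoski2023]
#3 CellParityLawSaving (crux, LOAD-BEARING; added 2026-08-17) — (the multi-character Bombieri law
ALONG THE SCHEDULE WITH A LOG-POWER SAVING) for all t ≥ 1 and L there are δ > 0 and N₀ such that for
N ≥ N₀, every non-degenerate d = 1 system Ψ (‖Ψ‖_N ≤ L) and every convex K ⊆ [−N,N] admit amplitudes
θ : Finset(Fin t) → ℝ with θ_∅ = 1, |θ_S| ≤ 2 and, for every j ∈ [1,U(N)]^t, |C_j − (Σ_S θ_S
∏_{i∈S}(−1)^{j_i+1})·archFactor Ψ K·singularProduct Ψ·∏_i A_{j_i}(N)/N| ≤ N/((log N)^t (log N)^δ),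
A_m(N) = #{n ≤ N : P⁻(n) > N^{1/U(N)}, Ω(n) = m} — DEFINITIONALLY the dip line's
`DipMarginRateExchange.CellParityLawSaving` (disprover-vetted: box containment load-bearing,
p114876). It implies the fixed-degree CellParityLaw only at u = U(N), not for every fixed u.
Content: the deviation of the joint cells from the independent-anatomy × singular-series model
depends on j only through its PARITY VECTOR, with Walsh mean 1, to accuracy (log N)^{−δ}.
[difficulty: open-problem] (why it might fail: A (log N)^{-δ} saving for every joint cell, uniform
in shifts ≤ LN, is Siegel–Walfisz-type strength for a parity-sensitive law: false under unbounded
Siegel zeros (unguarded); only known derivation is coordinatewise Bombieri under level-1 hypotheses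
(Ford2004); top cells j_i = U and the absolute allowance are typing-fragile.)
[BombieriAsymptoticSieve1976, FriedlanderIwaniecPisa1978, Ford2004, Alladi1982, GreenTao2010,
MatomakiMerikoski2023,
Summits/Parity/GeneralizedHardyLittlewood/Theorems/LeeYangFibresAbsoluteUpgradeDipDefs.lean,
Summits/Parity/GeneralizedHardyLittlewood/Theorems/AbsoluteUpgrade/Negative/CellParityLawSavingLoadBearing.lean,
Literature.Barriers.Parity.FordFixedLevelBarrier]
#3 CellParityLaw (crux, FIXED-DEGREE SHADOW; the original rank-3 item stmt-Parity-14109, off the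
cone, first milestone) — for all t ≥ 1, L, u ≥ 2, ε > 0: the joint cells at roughness u obey C_j =
Θ(parity vector of j)·M_j + O(εN/log^t N) with θ_∅ = 1, |θ_S| ≤ 2. [difficulty: open-problem] (why
it might fail: Only derivation: coordinatewise Bombieri under level-1 hypotheses for mixed
cell-weight sequences (EH + tuple-GEH), open beyond level 1/2 (Ford2004); shift-uniformity is
Siegel-sensitive; a normalisation slip (value scale vs N, archFactor, θ_∅ = 1, top cells) kills it
as typed.) [BombieriAsymptoticSieve1976, BombieriRIMS1977, FriedlanderIwaniecPisa1978, Ford2004,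
Alladi1982, GreenTao2010]
#4 ModelHyperbolicity (crux; PROVED 2026-08-16, line window-chain-transport,
Theorems/LeeYangFibresModelHyperbolicity*) — (card S3, parity-free; the model case) for every u ≥ 2
and all large x the rough-integer cell polynomial Σ_{j≤u} A_j(x) z^j has only real zeros. Negative
lemmas in tree: x₀(u) > 2^{u−1} and x₀(u)^{1/u} → ∞ (Theorems/ModelHyperbolicity/Negative/*) —
harmless along U(N), where N^{1/U} = exp(e^{4U²}/U). [difficulty: L] (why it might fail: settled —
proved.) [Alladi1982, Tenenbaum2015, KowalskiNikeghbali2010]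
#9 PrimeCellsRelative (crux by grade — NODE of the relative milestone, off the cone of `closes`;
implied by the fixed-degree cruxes via ModelCellFacts + HyperbolicityClipsParity, both PROVED; not
to be attacked directly) counting Dickson–Hardy–Littlewood for rough prime cells with Green–Tao's
Conj. 1.4 error shape. [difficulty: open-problem] (why it might fail: Open-problem strength on its
own: counting Dickson–HL for rough prime cells with Conj. 1.4 error, uniform in the shift;
Siegel-sensitive; a derived NODE; a cell/main-term normalisation slip falsifies it as typed.)
[GreenTao2010, HardyLittlewood1923, BombieriAsymptoticSieve1976]
#9 RelativeDimOne (crux by grade — NODE: the route's RELATIVE MILESTONE, = PrimeCellsRelative +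
CellsToRelativeDimOne (PROVED); off the cone of `closes` since the 2026-08-17 re-cut; also wanted by
route VarianceWitness) |vonMangoldtSum Ψ K N − archFactor Ψ K·singularProduct Ψ| ≤ ε·(archFactor Ψ
K·singularProduct Ψ + N) uniformly — the Λ-form of Green–Tao Conj. 1.4 at d = 1 (twins, Sophie
Germain, Goldbach-in-the-shift to relative o(1)); DimOne → RelativeDimOne is proved
(relativeDimOne_of_dimOne), the converse is the retired complementary sector. [difficulty:
open-problem] (why it might fail: Open-problem strength on its own: the Λ-form of Green–Tao Conj.
1.4 at d = 1, uniform over shifts; Siegel-sensitive (MatomakiMerikoski2023 Thm 1.3); a derived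
NODE.) [GreenTao2010, HardyLittlewood1923, MatomakiMerikoski2023]
#9 QuantitativeClipping (support, NEW, ROUTINE = already a theorem of the tree) CellParityLawSaving
→ FibreHyperbolicityAlong → DimOne: the quantitative clipping along u = U(N) — pencil Rouché through
the mod-Gamma disc asymptotic (MarginPoly, ModGammaDisc, PencilChainZero, all PROVED), Newton/Walsh
clipping of every fibre to a Walsh amplitude below U^{−m} (QuantClip p114484), rough-integer anatomy
along the schedule (AnatomyAlong p102212), partial summation with the landed bound ∏_pβ_p ≤ (C log
log N)^{t−1} (CellsToDimOne p100021); composed as `DipMarginRateExchange.dimOne_of_dipInputs`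
(p114853, axioms propext/choice/Quot.sound only). One-line proof for the item: `theorem
quantitativeClipping_proof : Theses.LeeYangFibres.QuantitativeClipping := fun hL hH =>
Cruxes.AbsoluteUpgrade.DipMarginRateExchange.dimOne_of_dipInputs hL hH` (planner Sketch.lean, rc 0:
both statements are `Iff.rfl`-equal to the dip line's). [difficulty: provable-now]
[Summits/Parity/GeneralizedHardyLittlewood/Theorems/LeeYangFibresAbsoluteUpgradeDipReduction.lean,
Greaves2001, Alladi1982, KowalskiNikeghbali2010]
#9 AbsoluteUpgrade (support since 2026-08-17; was the rank-9 complementary-sector crux)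
RelativeDimOne → DimOne — kernel-checked ≡ DimOne ∨ ¬RelativeDimOne (p121721), ≡ its high-mass core
given RelativeDimOne (p77305); a COROLLARY of the two rate cruxes (`absoluteUpgrade_of_dipInputs`,
p114853) and of the target (`absoluteUpgrade_of_target`); t = 1 / bounded-mass slices, Siegel guard,
m-uniform Gallagher and the amplification door `UniformRelativeDimOne → DimOne`
(Theorems/LeeYangFibresAbsoluteUpgradeUniformDoor) PROVED around it. Not staffed from this route
(every skeleton of it hides the summit — the 2026-08-17 gate finding this revision repairs); kept
because VarianceWitness wants it and forty Theorems files cite the decl. [GreenTao2010,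
Gallagher1976, MatomakiMerikoski2023,
Summits/Parity/GeneralizedHardyLittlewood/Cruxes/AbsoluteUpgrade/STRATEGY-CENSUS.md]
#9 ModelCellFacts (support; PROVED, `modelCellFacts_proof`) — parity-free anatomy of rough integers
(bulk cells ≥ cN/log N, vanishing log-concavity margins at one odd / one even bulk index, parity
balance). [Alladi1982, Tenenbaum2015]
#9 HyperbolicityClipsParity (support; PROVED, `HyperbolicityClipsParity_proof`) — CellParityLaw →
FibreHyperbolicity → ModelCellFacts → PrimeCellsRelative: Newton at two bulk indices + multiaffine
interpolation on {ρ(1), 1}^{t−1} (fixed-degree clipping, relative accuracy). [BorceaBranden2009,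
Wagner2011]
#9 CellsToRelativeDimOne (support; PROVED, `cellsToRelativeDimOne_proof`) — PrimeCellsRelative →
RelativeDimOne by partial summation + PNT. [GreenTao2010, MontgomeryVaughan2007]
#9 FibrationLemma (support; PROVED 2026-08-16, `leeYangFibres_fibrationLemma`, Theses-free core
`FibrationGlue.generalizedHardyLittlewood_of_dimOne`; shared stmt-Parity-0822) — DimOne →
GeneralizedHardyLittlewood: unimodular change of basis, fibres are d = 1 systems on intervals,
DimOne on the good fibres, fibre singular products average to β_∞∏_pβ_p [GreenTao2010, p. 6 and App.
A]. The fourth hypothesis of `closes`, admissible by class. [GreenTao2010]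

TWO-LAYER PLAN. Foreseen glued splits (k ≤ 3, depth 1), none filed now. CellParityLawSaving ⇐ [t =
1: Alladi cells of one progression segment along
U(N) with de la Vallée Poussin rate — provable, = AnatomyAlong + Siegel–Walfisz] → [t = 2: gen-1
RoughCellAlphaLaw for every pair of forms with a
(log N)^{−δ} saving] → [induction step t−1 ⇒ t] → CellParityLawSaving. FibreHyperbolicityAlong ⇐ [t
= 1: Ω-cells of rough integers in a progression
segment along U(N), parity-free: ModelHyperbolicity with an explicit threshold x₀(u) ≤ exp(exp(4u²))
+ AnatomyAlong + the pencil robustness radius]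
→ [t = 2, w → 0: the card's H(u) for every pair of forms] → [general t] → FibreHyperbolicityAlong.
Each fixed-degree shadow (FibreHyperbolicity,
CellParityLaw) is the natural first case of its rate form and is already staffed (registered
skeletons); a proof of a shadow with EXPLICIT dependence
N₀(u) ≤ exp(exp(4u²)) resp. ε(u,N) ≤ (log N)^{−δ} for u ≤ U(N) is a proof of the rate form — provers
on 14108/14109 should track their constants in u.

KILL CRITERIA. FibreHyperbolicityAlong refuted at the physical degree u = 4 (a non-real fibre zero
for some admissible (Ψ,K) of mass ≥ ηN at
arbitrarily large N — kit-checkable, cf. j018789) ⇒ the schedule's floor `max 4 …` is wrong: restate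
with a higher floor if the fixed-degree crux survives at
larger u (misstated), close `refuted:FibreHyperbolicityAlong` if complex pairs persist for all large
u (then in the Hardy–Littlewood world the zero-locus
form is dead and the weaker log-concavity-window form reverts to a card). FibreHyperbolicity (fixed
degree) refuted by a structural argument at t = 1 ⇒ close.
CellParityLawSaving refuted for some (t, j) ⇒ first re-check the typing (value scale ≤ 2LN vs model
scale N, archFactor's positivity region, θ_∅ = 1, top
cells j_i = U, the purely absolute allowance) and restate (misstated); a genuine failure of the
parity-vector FORM with a log-power saving would contradict
Bombieri's theorem under EH at t = 2 — close `refuted:CellParityLawSaving`; a failure of the SAVING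
only (law true to o(1) but not to (log N)^{−δ}) kills this
route's claim on the Statement and leaves the relative milestone: close
`refuted:CellParityLawSaving`, RelativeDimOne's chain survives in VarianceWitness.
RelativeDimOne refuted ⇒ DimOne and the Statement fail too (DimOne → RelativeDimOne is PROVED): the
sub-problem is decided negatively at d = 1. DimOne
proved elsewhere (DicksonFibration, PrimeDeterminantCells, HyperbolicConstellations, …) moots the
route; the cruxes keep stand-alone value (cell-resolved
statistics of prime tuples; MarginPoly and the mod-Gamma asymptotic are parity-free theorems already
landed).

NOT DECOMPOSED YET. The EH/tuple-GEH ⟹ CellParityLaw(Saving) vendoring (Bombieri's balanced general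
weights with a smooth sandwich of cell indicators; the
t-induction; which level hypothesis yields the (log N)^{−δ} saving); an explicit threshold x₀(u) for
ModelHyperbolicity compatible with the schedule (the
proved window-chain transport gives some x₀(u); the Negative lemmas force x₀(u)^{1/u} → ∞, far below
N^{1/U(N)}); the t-UNIFORM amplification door
(`UniformRelativeDimOne → DimOne`, PROVED, Theorems/LeeYangFibresAbsoluteUpgradeUniformDoor) is
recorded but NOT a line of this route — the Walsh clipping
constant 2^t(8·2^t + 2) (p97202) makes t ≍ log log N unreachable by this mechanism (census S2(c));
the planner's remark (NOTES, sketch) that the unguarded high-mass sector of DimOne is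
itself summit-equivalent (append one translated form ψ₁ + kW, W a (log N)^A-smooth primorial,
average over k by Siegel–Walfisz + one-translate Gallagher +
an upper-bound sieve) — why no complementary crux replaces AbsoluteUpgrade; the card's calibration
theorems
T1/T2 (circle theorem for Σ z^{Ω(n)}; W-tricked Σμ²(n)z^{ω(n)} zeros → 0, −1, −2, …) — fileable as
Literature theorems, no bearing on `closes`; genuine
multivariate real STABILITY of R (false at finite N generically, which is why the crux is
fibre-wise).

CHEAPEST FALSIFIER. (i) Kit, t = 2 at the physical degree u = U(N) = 4: Ψ = (n, n+h), h ∈ {2, 6, 30,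
210, 2310}, K = [1, N], N ∈ {10⁸, 10⁹}: certified
(Sturm/interval) root isolation of the fibre polynomials Σ_{j₁≤4}(Σ_{j₂≤4} C_{j₁j₂} w^{j₂}) ζ^{j₁}
for w ∈ {0.05, 0.25, 0.5, 1} and both coordinates — one
non-real pair at growing N kills FibreHyperbolicityAlong as typed (cdisprove j018789 found 144/144
real-rooted at N = 10⁸); (ii) same data, the law: within
each parity class σ ∈ {±}² the ratios C_j/M_j must agree to O((log N)^{−δ}) — fit δ; a ratio spread
not shrinking in N refutes the SAVING; (iii) parity-free, in Lean
first: ModelHyperbolicity's threshold at u = 4 (x₀(4) = 481 numerically) and MarginPoly's constants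
at u = 4…8 against the pencil thresholds θ*(u).

NUMBERS. Schedule: U(N) = max 4 ⌊√(log log N)/2⌋ = 4 for all N < exp(exp(100)); (log log N)^{t−1} ≤
(2U+2)^{2t−2}; law visibility (log N)^{−δ} =
exp(−4δU²(1+o(1))) ≪ U^{−U}; anatomy accuracy e^{−U²} = (log N)^{−1/4+o(1)}. Model cell densities
(gen-1 kit j000121): u = 6: I_j = 1, 1.609, 0.684,
0.0748, 0.00087 (j = 1…5); pencil thresholds θ*(u) of F(z) − θF(−z): 0.175 (u = 4), 0.055 (5), 0.020
(6), 0.010 (7), < 0.005 (u ≥ 8), ≈ e^{−0.94u} to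
u = 60 (c1 lead, j013691/j013893/j013661); mod-Gamma: real zeros of F_u at −1.0000, …, −5.0000 for u
≥ 22, relative error ≍ 1/u. sup over systems of size ≤ L at scale N of ∏_pβ_p ≍ (e^γ log log
N)^{t−1} (primorial shifts; p86331/p90245).
Walsh clipping constant 2^t(8·2^t+2) (p97202). Items after this revision: 15 = target + 7 crux-kind
(ranks 2,2,3,3,4,9,9; ModelHyperbolicity PROVED) + 6
supports (QuantitativeClipping NEW in-tree, AbsoluteUpgrade, four PROVED) + assembly (PROVED).
`closes`
hypotheses: 4 (2 cruxes + 2 routine supports, one proved, one a one-liner from p114853); open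
load-bearing leaves: FibreHyperbolicityAlong,
CellParityLawSaving (+ the QuantitativeClipping wrapper). BC probes (planner, 2026-08-17,
bc/Probe.lean importing only the Statement): #h21_crux_probe
CLEAN 3/3; C → S by exact-id/simpa/unfold/aesop/exact? fails 2/2.

DEFINITION REQUESTS. None: cells, fibres and the schedule are inlined with Mathlib's Nat.minFac,
ArithmeticFunction.cardFactors, Nat.floor, Real.sqrt/log over
the Statement module's AffLinForm / latticeBox / realPoint / archFactor / singularProduct /
vonMangoldtSum (the Theorems-side names `ModelTransfer.jointCell/fibre`,
`Negative.cell`, `DipMarginRateExchange.slowDegree` agree with the inlined terms by `rfl`).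

Novelty: Searches (2026-08-15): `lit galaxy search --star all` ×2 substring ("real stable polynomial prime
k-tuples"; "number of prime factors
generating polynomial real zeros sieve": 0 hits each); `lit galaxy search --star pdf --mode
intelligent` ("generating polynomial of
almost-prime counts by Ω with only real zeros (hyperbolic / real stable / Lee–Yang) used to remove
the parity obstruction for twin primes
or prime k-tuples": 10 hits — Pemantle's survey arXiv:1210.3231, Murty's and Granville's prime
surveys, Kontorovich's affine-sieve
survey, two Oberwolfach reports; none puts a zero-locus hypothesis on almost-prime cells); `lit
frontier Parity --since 2021` (30 rows:
Bateman–Horn statistics, polynomial patterns, Chowla variants, higher uniformity II — nothing on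
cell polynomials); `lit bridges Parity
--cross any` (30 generic monographs); `lit search` / `lit vsearch` (searchd rc 75 all session —
recorded as not consulted); the gen-1
route's audited searches (hybrid ×3, galaxy ×5, intelligent ×1) and the card's novelty audit
(refuter 13-0: primon gas
Spector/Julia, Kowalski–Nikeghbali mod-Poisson 1/Γ, LPRS zeros ⟹ CLT) READ; the four open Theses
files of the sub and the negatives
index (2 unrelated refutations) READ; SignGhost.lean (Polymath §8 sign-pattern ghosts) READ — it is
the Walsh structure the law concedes.
Nearest prior art found: BombieriAsymptoticSieve1976 / FriedlanderIwaniecPisa1978 (one-parameter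
parity law of a level-1 sequence —
the t = 2 case of CellParityLaw); rout  [refs: 1210.3231, BombieriAsymptoticSieve1976, FriedlanderIwaniecPisa1978, BorceaBrandenLiggett2007, KowalskiNikeghbali2010, Wagner2011]

Barriers (technique_class: lee-yang-zeros, hyperbolicity, asymptotic-sieve): - technique_class: lee-yang-zeros, hyperbolicity, asymptotic-sieve
- Literature.Barriers.Parity.SelbergParityBarrier: not evaded by Type-I means and not claimed to be
— FibreHyperbolicity is parity-sensitive by construction (an amplitude θ_S = ±1 makes the
corresponding fibre an even or odd polynomial: zeros on iℝ, maximally non-hyperbolic), hence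
underivable from level-of-distribution axioms; it is the declared extra input, to be proved, if at
all, from zero-locus structure (interlacing along Buchstab-type recursions, stability preservers),
never from sieve bounds.
- Literature.Barriers.Parity.PrimePairParity: same accounting; and its T-generalisation, the
sign-pattern ghosts `HasSignGhost` of Literature/Barriers/Parity/SignGhost.lean (Polymath8b2014 §8):
the ghosts are non-negative polynomials in the signs λ(ψ_i(n)) with no degree-1 Walsh mass — exactly
the directions θ_S, |S| ≥ 2, that CellParityLaw leaves free (it even frees |S| = 1); the route does
not insert weights, it constrains the ghosts' amplitudes by the zero locus, a hypothesis no
ghost-reweighted world satisfies.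
- Literature.Barriers.Parity.FordFixedLevelBarrier: bites on crux 3 — the law needs level x^{1−ε}
for every ε for the mixed cell-weight sequences (EH/tuple-GEH ⟹ it); a fixed level ν < 1 cannot
force cell asymptotics (Ford's sequences); no unconditional proof of crux 3 from Bombieri–Vinogradov
is claimed.
- Literature.Barriers.Parity.LargeSieveLevelHalf: EH/GEH are imported into NO statement; they are o

History (route lifecycle, newest last):
- 2026-08-16T04:03:47Z · rev 2: restated Assembly (stmt-Parity-14117) — route-repair (ground-failed, planner rground-4f69541d, 2026-08-16): the only ground flag was Assembly (stmt-Parity-14117) `ground.trivial: intros; aesop` — as t (planner-rground-Parity-LeeYangFibres-4f69541d-0)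
- 2026-08-17T07:36:35Z · skeleton.hides-summit: stub_uniformRelativeDimOne (stmt-Parity-14116) ⟷ summit (accepted theorem in Summits/Parity/GeneralizedHardyLittlewood/Theorems/LeeYangFibresAbsoluteUpgradeUniformDoor.lean) (prover-line-stmt-Parity-14116-c10-0)
- 2026-08-17T11:56:10Z · skeleton.hides-summit: stub_twoFlatFactors (stmt-Parity-0819) ⟷ summit (accepted theorem in Summits/Parity/GeneralizedHardyLittlewood/Theorems/DicksonFibrationDimOneEquivalence.lean) (prover-line-stmt-Parity-0819-c2-0)
- 2026-08-24T18:42:15Z · DORMANT — reconciler: no traction for 7 d (last activity item-evidence-added at 2026-08-17T18:32:04Z); parked, not closed — `ledger route dormant route-Parity-LeeYangFibr (operator:999:3314130)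

sub-problem: GeneralizedHardyLittlewood · status: dormant · opened planner-plancard-Parity-GeneralizedHardyLittl-fda775fa-g2-0 2026-08-15T19:06:12Z · rev 8 · ledger route-Parity-LeeYangFibres
GENERATED by the gate from the ledger (D-0016/17). Provers cite these decls: `theorem foo : Summit.Parity.GeneralizedHardyLittlewood.Theses.LeeYangFibres.<Decl> := …` in Summits/Parity/GeneralizedHardyLittlewood/Theorems/<Name>.lean.
-/

namespace Summit.Parity.GeneralizedHardyLittlewood.Theses.LeeYangFibres

open scoped BigOperators Topology Manifold Classical MeasureTheory ProbabilityTheory Matrix InnerProductSpace ComplexConjugate ContinuousMap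
open Filter Set Function TopologicalSpace MeasureTheory

attribute [summit_statement] _root_.GeneralizedHardyLittlewood

/-- item stmt-Parity-0819 · target · rank 0 · open · by planner
why it might fail: = uniform Dickson/HL incl. twins, Sophie Germain, Goldbach in the shift; Siegel-sensitive as typed (MatomakiMerikoski2023 Thm 1.3); parity blocks sieves; GTZ vacuous at d = 1.
sources: GreenTao2010, MatomakiMerikoski2023, GoldstonSuriajaya2021, HardyLittlewood1923
[crux] The d = 1 case of Literature.NumberTheory.Sieve.GeneralizedHardyLittlewood
(Dickson–Hardy–Littlewood, Λ-weighted): for all t ≥ 1, L, uniformly over non-degenerate systems of t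
forms a_i n + b_i with ‖Ψ‖_N ≤ L (so |b_i| ≤ L N) and intervals K ⊆ [-N, N]: |∑_{n ∈ K} ∏ Λ(a_i n +
b_i) − β_∞ ∏_p β_p| ≤ ε N for N ≥ N₀(t, L, ε). Open (contains twin primes, Sophie Germain, Goldbach
asymptotics uniformly in the shift). GHL → DimOne is immediate; the route's content is the converse
(Assembly). [GreenTao2010, Conj. 1.2, p. 6] -/
@[route_item "route-Parity-LeeYangFibres", crux]
def DimOne : Prop :=
  ∀ (t L : ℕ), 1 ≤ t → ∀ ε : ℝ, 0 < ε → ∃ N₀ : ℕ, ∀ N : ℕ, N₀ ≤ N → ∀ Ψ : Fin t → Literature.NumberTheory.Sieve.AffLinForm 1, Literature.NumberTheory.Sieve.IsNondegenerateSystem Ψ → Literature.NumberTheory.Sieve.affLinSize Ψ N ≤ L → ∀ K : Set (Fin 1 → ℝ), Convex ℝ K → K ⊆ Literature.NumberTheory.Sieve.realBox 1 N → |Literature.NumberTheory.Sieve.vonMangoldtSum Ψ K N - Literature.NumberTheory.Sieve.archFactor Ψ K * Literature.NumberTheory.Sieve.singularProduct Ψ| ≤ ε * (N : ℝ)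

/-- item stmt-Parity-14108 · crux · rank 2 · open · by planner
why it might fail: Given the law it is HL-strength parity content with almost no slack (gen-1 calibration θ*(6)≈0.02, kit j000121) and no sieve proof; ghosts θ_S=±1 put fibre zeros on iℝ; shift-uniform, so false under a Siegel zero (resonant (n, n+q₁): θ=±1); noisy top cells at finite N.
sources: LeeYang1952, HeilmannLieb1972, BorceaBranden2009, BorceaBrandenLiggett2007, Wagner2011, arXiv:1210.3231
[crux] (card C2 = H(u), one fugacity per form, cofinal in u) for all t ≥ 1, L, u₀ and η > 0 there
are u ≥ max(u₀,2) and N₀ such that for N ≥ N₀, every non-degenerate d = 1 system Ψ of t forms with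
‖Ψ‖_N ≤ L, every convex K ⊆ [−N,N] with archFactor Ψ K · singularProduct Ψ ≥ ηN, every coordinate i
and every frozen fugacity vector w ∈ (0,1]^t: the fibre polynomial ζ ↦ Σ_{j∈[1,u]^t} C_j(Ψ,K,N,u)
ζ^{j_i} ∏_{k≠i} w_k^{j_k} has only real zeros, where C_j = #{n ∈ K∩ℤ : N^{1/u} < P⁻(ψ_k(n)) and
Ω(ψ_k(n)) = j_k for all k}. Limits: w → 0 on the other forms = "the other forms prime" (t = 2: the
card's rough cells of p+h); w = 1 = "the other forms u-rough". The non-sieve input of the route.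
[difficulty: open-problem] -/
@[route_item "route-Parity-LeeYangFibres", crux]
def FibreHyperbolicity : Prop :=
  ∀ (t L u₀ : ℕ), 1 ≤ t → ∀ η : ℝ, 0 < η → ∃ u : ℕ, u₀ ≤ u ∧ 2 ≤ u ∧ ∃ N₀ : ℕ, ∀ N : ℕ, N₀ ≤ N → ∀ Ψ : Fin t → Literature.NumberTheory.Sieve.AffLinForm 1, Literature.NumberTheory.Sieve.IsNondegenerateSystem Ψ → Literature.NumberTheory.Sieve.affLinSize Ψ N ≤ L → ∀ K : Set (Fin 1 → ℝ), Convex ℝ K → K ⊆ Literature.NumberTheory.Sieve.realBox 1 N → η * (N : ℝ) ≤ Literature.NumberTheory.Sieve.archFactor Ψ K * Literature.NumberTheory.Sieve.singularProduct Ψ → ∀ i : Fin t, ∀ w : Fin t → ℝ, (∀ k, 0 < w k ∧ w k ≤ 1) → ∀ ζ : ℂ, (∑ j ∈ Fintype.piFinset (fun _ : Fin t => Finset.Icc 1 u), ((((Literature.NumberTheory.Sieve.latticeBox 1 N).filter (fun n => Literature.NumberTheory.Sieve.realPoint n ∈ K ∧ ∀ k, (N : ℝ) ^ ((1 : ℝ)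 / u) < (Nat.minFac ((Ψ k).eval n).toNat : ℝ) ∧ ArithmeticFunction.cardFactors ((Ψ k).eval n).toNat = j k)).card : ℕ) : ℂ) * ∏ k, (if k = i then ζ else ((w k : ℝ) : ℂ)) ^ (j k)) = 0 → ζ.im = 0

/-- item stmt-Parity-18103 · crux · rank 2 · open · by planner
why it might fail: HL-strength parity content; along U(N) the cells must track the tilted model row to relative accuracy ≪ U^{-U} (the pencil's robustness radius); U = 4 for every N < exp(exp(100)); unguarded, so false under unbounded Siegel zeros; hides 'some rough t-tuple in every K of mass ≥ ηN'.
sources: LeeYang1952, HeilmannLieb1972, BorceaBranden2009, Wagner2011, KowalskiNikeghbali2010, MatomakiMerikoski2023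
[crux] (fibre hyperbolicity ALONG THE SCHEDULE u = U(N) := max 4 ⌊√(log log N)/2⌋ — the u-uniform
clause of the card's H(u), one fugacity per form; LOAD-BEARING hypothesis of `closes` since the
2026-08-17 re-cut) for all t ≥ 1, L and η > 0 there is N₀ such that for N ≥ N₀, every non-degenerate
d = 1 system Ψ of t forms with ‖Ψ‖_N ≤ L, every convex K ⊆ [−N,N] with archFactor Ψ K ·
singularProduct Ψ ≥ ηN, every coordinate i and every frozen fugacity vector w ∈ (0,1]^t: the fibre
polynomial ζ ↦ Σ_{j∈[1,U(N)]^t} C_j ζ^{j_i} ∏_{k≠i} w_k^{j_k} has only real zeros, C_j = #{n ∈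
K∩ℤ∩[−N,N] : N^{1/U(N)} < P⁻(ψ_k(n)) and Ω(ψ_k(n)) = j_k for all k}. DEFINITIONALLY (Iff.rfl) the
dip line's `Cruxes.AbsoluteUpgrade.DipMarginRateExchange.FibreHyperbolicityAlong`
(Theorems/LeeYangFibresAbsoluteUpgradeDipDefs), i.e. the type of its guarded stub with the inert
RelativeDimOne guard removed; disprover-vetted (mass floor, convexity, w_k > 0 load-bearing:
Theorems/AbsoluteUpgrade/Negative/FibreHyperbolicityAlongLoadBearing, p113523; kit j018789: 144/144
fibres real-rooted at N = 10⁸, u = 4). Not comparable with the fixed-degree crux FibreHyperbolicity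
(cofinal ∃u): neither implies the other. With CellPar -/
@[route_item "route-Parity-LeeYangFibres", crux]
def FibreHyperbolicityAlong : Prop :=
  ∀ (t L : ℕ), 1 ≤ t → ∀ η : ℝ, 0 < η → ∃ N₀ : ℕ, ∀ N : ℕ, N₀ ≤ N → ∀ Ψ : Fin t → Literature.NumberTheory.Sieve.AffLinForm 1, Literature.NumberTheory.Sieve.IsNondegenerateSystem Ψ → Literature.NumberTheory.Sieve.affLinSize Ψ N ≤ L → ∀ K : Set (Fin 1 → ℝ), Convex ℝ K → K ⊆ Literature.NumberTheory.Sieve.realBox 1 N → η * (N : ℝ) ≤ Literature.NumberTheory.Sieve.archFactor Ψ K * Literature.NumberTheory.Sieve.singularProduct Ψ → ∀ i : Fin t, ∀ w : Fin t → ℝ, (∀ k, 0 < w k ∧ w k ≤ 1) → ∀ ζ : ℂ, (∑ j ∈ Fintype.piFinset (fun _ : Fin t => Finset.Icc 1 (max 4 ⌊Real.sqrt (Real.log (Real.log N)) / 2⌋₊)), ((((Literature.NumberTheory.Sieve.latticeBox 1 N).filter (fun n => Literature.NumberTheory.Sieve.realPoint n ∈ K ∧ ∀ k, (N : ℝ)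 ^ ((1 : ℝ) / (max 4 ⌊Real.sqrt (Real.log (Real.log N)) / 2⌋₊ : ℕ)) < (Nat.minFac ((Ψ k).eval n).toNat : ℝ) ∧ ArithmeticFunction.cardFactors ((Ψ k).eval n).toNat = j k)).card : ℕ) : ℂ) * ∏ k, (if k = i then ζ else ((w k : ℝ) : ℂ)) ^ (j k)) = 0 → ζ.im = 0

/-- item stmt-Parity-14109 · crux · rank 3 · open · by planner
why it might fail: Only derivation: coordinatewise Bombieri under level-1 hypotheses for mixed cell-weight sequences (EH + tuple-GEH), open beyond level 1/2 (Ford2004); shift-uniformity is Siegel-sensitive; a normalisation slip (value scale vs N, archFactor, θ_∅ = 1, top cells) kills it as typed.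
sources: BombieriAsymptoticSieve1976, BombieriRIMS1977, FriedlanderIwaniecPisa1978, Friedlander2006ProducingPrimes, Polymath8b2014, Ford2004
[crux] (multi-character Bombieri law for joint rough cells, EH-free typing) for all t ≥ 1, L, u ≥ 2,
ε > 0 there is N₀ such that for N ≥ N₀, every non-degenerate d = 1 system Ψ (‖Ψ‖_N ≤ L) and every
convex K ⊆ [−N,N] admit amplitudes θ : Finset(Fin t) → ℝ with θ_∅ = 1, |θ_S| ≤ 2 and, for every j ∈
[1,u]^t, |C_j − (Σ_S θ_S ∏_{i∈S}(−1)^{j_i+1})·archFactor Ψ K·singularProduct Ψ·∏_i A_{j_i}(N)/N| ≤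
εN/log^t N, A_j(N) = #{m ≤ N : P⁻(m) > N^{1/u}, Ω(m) = j}. Content: the deviation of the cells from
the independent-anatomy × singular-series model depends on j only through its PARITY VECTOR, with
Walsh mean 1. t = 1: Landau–Alladi cells of one progression segment (θ → 0, PNT level). t = 2, Ψ =
(n, n+h): gen-1's RoughCellAlphaLaw (Bombieri's one-parameter law; EH ⟹ it). General t:
coordinatewise Bombieri with unknown masses, by induction on t, under level-1 hypotheses for the
mixed cell-weight sequences (tuple-GEH) — filed unconditionally so that no unproved cone fact is
imported. [difficulty: open-problem] -/
@[route_item "route-Parity-LeeYangFibres", crux]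
def CellParityLaw : Prop :=
  ∀ (t L u : ℕ), 1 ≤ t → 2 ≤ u → ∀ ε : ℝ, 0 < ε → ∃ N₀ : ℕ, ∀ N : ℕ, N₀ ≤ N → ∀ Ψ : Fin t → Literature.NumberTheory.Sieve.AffLinForm 1, Literature.NumberTheory.Sieve.IsNondegenerateSystem Ψ → Literature.NumberTheory.Sieve.affLinSize Ψ N ≤ L → ∀ K : Set (Fin 1 → ℝ), Convex ℝ K → K ⊆ Literature.NumberTheory.Sieve.realBox 1 N → ∃ θ : Finset (Fin t) → ℝ, θ ∅ = 1 ∧ (∀ S, |θ S| ≤ 2) ∧ ∀ j : Fin t → ℕ, (∀ i, 1 ≤ j i ∧ j i ≤ u) → |((((Literature.NumberTheory.Sieve.latticeBox 1 N).filter (fun n => Literature.NumberTheory.Sieve.realPoint n ∈ K ∧ ∀ i, (N : ℝ) ^ ((1 : ℝ) / u) < (Nat.minFac ((Ψ i).eval n).toNat : ℝ) ∧ ArithmeticFunction.cardFactors ((Ψ i).eval n).toNat = j i)).card : ℕ) : ℝ) - (∑ S : Finset (Fin t), θ S * ∏ i ∈ S, (-1 : ℝ) ^ (j i + 1)) * (Literature.NumberTheory.Sieve.archFactor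 Ψ K * Literature.NumberTheory.Sieve.singularProduct Ψ * ∏ i, ((((Finset.Icc 1 N).filter (fun m => (N : ℝ) ^ ((1 : ℝ) / u) < (Nat.minFac m : ℝ) ∧ ArithmeticFunction.cardFactors m = j i)).card : ℕ) : ℝ) / N)| ≤ ε * N / Real.log N ^ t

/-- item stmt-Parity-18104 · crux · rank 3 · open · by planner
why it might fail: A (log N)^{-δ} saving for every joint cell, uniform in shifts ≤ LN, is Siegel–Walfisz strength for a parity-sensitive law: false under unbounded Siegel zeros (unguarded); only derivation: coordinatewise Bombieri under level-1 hypotheses (Ford2004); top cells / absolute allowance typing-fragile.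
sources: BombieriAsymptoticSieve1976, FriedlanderIwaniecPisa1978, Ford2004, Alladi1982, GreenTao2010, MatomakiMerikoski2023
[crux] (the multi-character Bombieri law for joint rough cells ALONG THE SCHEDULE WITH A LOG-POWER
SAVING; LOAD-BEARING hypothesis of `closes` since the 2026-08-17 re-cut) for all t ≥ 1 and L there
are δ > 0 and N₀ such that for N ≥ N₀, every non-degenerate d = 1 system Ψ (‖Ψ‖_N ≤ L) and every
convex K ⊆ [−N,N] admit amplitudes θ : Finset(Fin t) → ℝ with θ_∅ = 1, |θ_S| ≤ 2 and, for every j ∈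
[1,U(N)]^t, |C_j − (Σ_S θ_S ∏_{i∈S}(−1)^{j_i+1})·archFactor Ψ K·singularProduct Ψ·∏_i A_{j_i}(N)/N|
≤ N/((log N)^t (log N)^δ), where U(N) = max 4 ⌊√(log log N)/2⌋ and A_m(N) = #{n ≤ N : P⁻(n) >
N^{1/U(N)}, Ω(n) = m}. Content: the deviation of the joint cells from the independent-anatomy ×
singular-series model depends on j only through its PARITY VECTOR, with Walsh mean 1, to accuracy
(log N)^{−δ}. DEFINITIONALLY (Iff.rfl) the dip line's
`Cruxes.AbsoluteUpgrade.DipMarginRateExchange.CellParityLawSaving`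
(Theorems/LeeYangFibresAbsoluteUpgradeDipDefs; guard removed); disprover-vetted (box containment
load-bearing: Theorems/AbsoluteUpgrade/Negative/CellParityLawSavingLoadBearing, p114876). Implies
the fixed-degree CellParityLaw only at u = U(N). t = 1: Alladi cells of one progression segment
along -/
@[route_item "route-Parity-LeeYangFibres", crux]
def CellParityLawSaving : Prop :=
  ∀ (t L : ℕ), 1 ≤ t → ∃ δ : ℝ, 0 < δ ∧ ∃ N₀ : ℕ, ∀ N : ℕ, N₀ ≤ N → ∀ Ψ : Fin t → Literature.NumberTheory.Sieve.AffLinForm 1, Literature.NumberTheory.Sieve.IsNondegenerateSystem Ψ → Literature.NumberTheory.Sieve.affLinSize Ψ N ≤ L → ∀ K : Set (Fin 1 → ℝ), Convex ℝ K → K ⊆ Literature.NumberTheory.Sieve.realBox 1 N → ∃ θ : Finset (Fin t) → ℝ, θ ∅ = 1 ∧ (∀ S, |θ S| ≤ 2) ∧ ∀ j : Fin t → ℕ, (∀ i, 1 ≤ j i ∧ j i ≤ max 4 ⌊Real.sqrt (Real.log (Real.log N)) / 2⌋₊) → |((((Literature.NumberTheory.Sieve.latticeBox 1 N).filter (fun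 n => Literature.NumberTheory.Sieve.realPoint n ∈ K ∧ ∀ k, (N : ℝ) ^ ((1 : ℝ) / (max 4 ⌊Real.sqrt (Real.log (Real.log N)) / 2⌋₊ : ℕ)) < (Nat.minFac ((Ψ k).eval n).toNat : ℝ) ∧ ArithmeticFunction.cardFactors ((Ψ k).eval n).toNat = j k)).card : ℕ) : ℝ) - (∑ S : Finset (Fin t), θ S * ∏ i ∈ S, (-1 : ℝ) ^ (j i + 1)) * (Literature.NumberTheory.Sieve.archFactor Ψ K * Literature.NumberTheory.Sieve.singularProduct Ψ * ∏ i, ((((Finset.Icc 1 N).filter (fun n => (N : ℝ) ^ ((1 : ℝ) / (max 4 ⌊Real.sqrt (Real.log (Real.log N)) / 2⌋₊ : ℕ)) < (Nat.minFac n : ℝ) ∧ ArithmeticFunction.cardFactors n = j i)).card : ℕ) : ℝ) / N)| ≤ (N : ℝ) / (Real.log N ^ t * Real.log N ^ δ)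

/-- item stmt-Parity-14110 · crux · rank 4 · closed · proved by Summit.Parity.GeneralizedHardyLittlewood.Cruxes.ModelHyperbolicity.WindowChainTransport.ModelHyperbolicity_of (prover) · by planner
why it might fail: Parity-free; numerically all zeros of F(u,·) are real and simple for u ∈ [2.5, 30] (kit j000121, grid 10⁻³, exact Sturm), but nothing is proved beyond degree 3, no interlacing along the Buchstab recursion is known, and one complex pair at one u refutes it as stated.
sources: Alladi1982, Tenenbaum2015, Lichtman2025LinearSieve, Literature.NumberTheory.Sieve.buchstabOmega, KowalskiNikeghbali2010, arXiv:1410.6601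
[crux] (card S3, parity-free; the model case and cheapest falsifier of crux 2, not a hypothesis of
`closes`) for every u ≥ 2 and all large x the rough-integer cell polynomial Σ_{j≤u} A_j(x) z^j has
only real zeros — VERBATIM LeeYangRoughCells.ModelHyperbolicity (stmt-Parity-7944, re-attached). Up
to simplicity of zeros: the Buchstab–Dickman cell polynomial F(u,z) = Σ_j I_j(u) z^j (I₁ = 1, ∂_u
I_j = I_{j−1}(u−1)/(u−1), Σ_j I_j = uω(u)) is real-rooted for every u; kit j000121 (gen-1): real
simple zeros for every u ∈ {2.5, 3, …, 30}. [difficulty: L] -/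
@[route_item "route-Parity-LeeYangFibres"]
def ModelHyperbolicity : Prop :=
  ∀ u : ℕ, 2 ≤ u → ∃ x₀ : ℕ, ∀ x : ℕ, x₀ ≤ x → ∀ z : ℂ, (∑ j ∈ Finset.range (u + 1), ((((Finset.Icc 1 x).filter (fun n => (x : ℝ) ^ ((1 : ℝ) / u) < (Nat.minFac n : ℝ) ∧ ArithmeticFunction.cardFactors n = j)).card : ℕ) : ℂ) * z ^ j) = 0 → z.im = 0

/-- item stmt-Parity-14112 · crux · rank 9 · open · by planner
why it might fail: Open-problem strength on its own: counting Dickson–HL for rough prime cells with Conj. 1.4 error, uniform in the shift (HL k-tuples, twins to relative o(1)); Siegel-sensitive; a derived NODE reached only via cruxes 2–3 + clipping; a cell/main-term normalisation slip falsifies it as typed.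
sources: GreenTao2010, HardyLittlewood1923, BombieriAsymptoticSieve1976
[support] (the route's cell-level output; implied by cruxes 2–3 via the two supports above) for all
t ≥ 1, L, ε > 0 there are u ≥ 2 and N₀ such that for N ≥ N₀, uniformly over non-degenerate Ψ (‖Ψ‖_N
≤ L) and convex K ⊆ [−N,N]: |#{n ∈ K∩ℤ : every ψ_i(n) prime > N^{1/u}} − M₁| ≤ ε(M₁ + N/log^t N), M₁
= archFactor Ψ K·singularProduct Ψ·(A₁(N)/N)^t, A₁(N) = π(N) − π(N^{1/u}). The counting form of
Dickson–Hardy–Littlewood with Green–Tao's Conj. 1.4 error shape (relative + absolute). [difficulty: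
open-problem] -/
@[route_item "route-Parity-LeeYangFibres"]
def PrimeCellsRelative : Prop :=
  ∀ (t L : ℕ), 1 ≤ t → ∀ ε : ℝ, 0 < ε → ∃ u : ℕ, 2 ≤ u ∧ ∃ N₀ : ℕ, ∀ N : ℕ, N₀ ≤ N → ∀ Ψ : Fin t → Literature.NumberTheory.Sieve.AffLinForm 1, Literature.NumberTheory.Sieve.IsNondegenerateSystem Ψ → Literature.NumberTheory.Sieve.affLinSize Ψ N ≤ L → ∀ K : Set (Fin 1 → ℝ), Convex ℝ K → K ⊆ Literature.NumberTheory.Sieve.realBox 1 N → |((((Literature.NumberTheory.Sieve.latticeBox 1 N).filter (fun n => Literature.NumberTheory.Sieve.realPoint n ∈ K ∧ ∀ i, (N : ℝ) ^ ((1 : ℝ) / u) < (Nat.minFac ((Ψ i).eval n).toNat : ℝ) ∧ ArithmeticFunction.cardFactors ((Ψ i).eval n).toNat = 1)).card : ℕ) : ℝ) - Literature.NumberTheory.Sieve.archFactor Ψ K * Literature.NumberTheory.Sieve.singularProduct Ψ * (((((Finset.Icc 1 N).filter (fun m => (N : ℝ) ^ ((1 : ℝ) / u) < (Nat.minFac m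 : ℝ) ∧ ArithmeticFunction.cardFactors m = 1)).card : ℕ) : ℝ) / N) ^ t| ≤ ε * (Literature.NumberTheory.Sieve.archFactor Ψ K * Literature.NumberTheory.Sieve.singularProduct Ψ * (((((Finset.Icc 1 N).filter (fun m => (N : ℝ) ^ ((1 : ℝ) / u) < (Nat.minFac m : ℝ) ∧ ArithmeticFunction.cardFactors m = 1)).card : ℕ) : ℝ) / N) ^ t + N / Real.log N ^ t)

/-- item stmt-Parity-14113 · crux · rank 9 · open · by planner
why it might fail: Open-problem strength on its own: the Λ-form of Green–Tao Conj. 1.4 at d = 1, uniform over shifts (twins, Sophie Germain, Goldbach to relative o(1)); Siegel-sensitive (MatomakiMerikoski2023 Thm 1.3); a derived NODE reached only via PrimeCellsRelative + partial summation.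
sources: GreenTao2010, HardyLittlewood1923, MatomakiMerikoski2023
[support] (the route's d = 1 output) for all t ≥ 1, L, ε > 0 there is N₀ such that for N ≥ N₀,
uniformly over non-degenerate d = 1 systems Ψ with ‖Ψ‖_N ≤ L and convex K ⊆ [−N,N]: |vonMangoldtSum
Ψ K N − archFactor Ψ K·singularProduct Ψ| ≤ ε·(archFactor Ψ K·singularProduct Ψ + N) — DimOne with
the relative + absolute error of Green–Tao Conj. 1.4 (Λ-form); equal to DimOne on systems of bounded
singular product, weaker exactly on the systems with ∏_pβ_p → ∞ (many collision primes, e.g. shifts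
h with ω(h) ≍ log log N). Contains fixed-tuple Hardy–Littlewood, uniform twins and Goldbach
asymptotics to relative accuracy o(1); Siegel-sensitive. [difficulty: open-problem] -/
@[route_item "route-Parity-LeeYangFibres", crux]
def RelativeDimOne : Prop :=
  ∀ (t L : ℕ), 1 ≤ t → ∀ ε : ℝ, 0 < ε → ∃ N₀ : ℕ, ∀ N : ℕ, N₀ ≤ N → ∀ Ψ : Fin t → Literature.NumberTheory.Sieve.AffLinForm 1, Literature.NumberTheory.Sieve.IsNondegenerateSystem Ψ → Literature.NumberTheory.Sieve.affLinSize Ψ N ≤ L → ∀ K : Set (Fin 1 → ℝ), Convex ℝ K → K ⊆ Literature.NumberTheory.Sieve.realBox 1 N → |Literature.NumberTheory.Sieve.vonMangoldtSum Ψ K N - Literature.NumberTheory.Sieve.archFactor Ψ K * Literature.NumberTheory.Sieve.singularProduct Ψ| ≤ ε * (Literature.NumberTheory.Sieve.archFactor Ψ K * Literature.NumberTheory.Sieve.singularProduct Ψ + N)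

/-- item stmt-Parity-0822 · support · rank 9 · closed · proved by Summit.Parity.GeneralizedHardyLittlewood.Theorems.leeYangFibres_fibrationLemma (prover) · by planner
sources: GreenTao2010
[assembly] The fibration lemma DimOne → GeneralizedHardyLittlewood [GreenTao2010, p. 6: 'holding d −
1 of the variables fixed and summing in the remaining one']. PROVABLE but sizable: (i) unimodular
change of basis of ℤ^d making every linear part non-vanishing on e₁ (affLinSize and realBox change
by C(d,t,L): rescale N); (ii) fibres K_w = K ∩ (w + ℝe₁) are intervals ⊆ [-CN, CN], fibre systems
are d = 1 systems with constants ≤ C L N, non-degenerate off O_t(N^{d−2}) fibres (trivial bound N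
log^t N on those); (iii) DimOne on each good fibre with N₀ uniform in w; (iv) main terms ∑_w |K_w ∩
{Ψ_w > 0}|·∏_p β_p(Ψ_w) = β_∞ ∏_p β_p + o(N^d) via FibreSingularProduct-type averaging weighted by
fibre lengths [GreenTao2010, App. A]. -/
@[route_item "route-Parity-LeeYangFibres", crux]
def FibrationLemma : Prop :=
  DimOne → GeneralizedHardyLittlewood

/-- item stmt-Parity-14111 · support · rank 9 · closed · proved by Summit.Parity.GeneralizedHardyLittlewood.Theorems.modelCellFacts_proof (prover) · by planner
sources: Alladi1982, Tenenbaum2015, Lichtman2025LinearSieve, Harman2007, Literature.NumberTheory.Sieve.buchstabOmega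
[support] (parity-free anatomy of rough integers, provable now) for every ε > 0 and all large u
there are an odd j₁ and an even j₂ with 2 ≤ j₁, j₂ ≤ u − 2, a constant c > 0 and N₀ such that for N
≥ N₀: A_j(N) ≥ cN/log N for j ∈ {1, j₁±1, j₁, j₂±1, j₂}; the log-concavity margins vanish at j₁, j₂:
(1−ε)A_j² ≤ A_{j−1}A_{j+1}; and the parity of Ω is balanced on N^{1/u}-rough integers: |Σ_j (−1)^j
A_j(N)| ≤ ε Σ_j A_j(N). Inputs: A_j(N) ~ I_j(u) N/log N (Alladi1982; induction on j over the tree's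
Buchstab machinery RoughNumbersBuchstab.lean), I_j(u) ~ (log u)^{j−1}/(j−1)! so r_j(u) =
I_j²/(I_{j−1}I_{j+1}) → j/(j−1) (take j₁, j₂ > 1 + 2/ε), and the alternating Buchstab function ℓ(u)
((uℓ)' = −ℓ(u−1), uℓ = −1 on (1,2]) tends to 0 (Alladi, Trans. AMS 272 (1982); Tenenbaum2015 III.6).
[difficulty: provable-now] -/
@[route_item "route-Parity-LeeYangFibres", crux]
def ModelCellFacts : Prop :=
  ∀ ε : ℝ, 0 < ε → ∃ u₀ : ℕ, ∀ u : ℕ, u₀ ≤ u → ∃ j₁ j₂ : ℕ, Odd j₁ ∧ Even j₂ ∧ 2 ≤ j₁ ∧ j₁ + 2 ≤ u ∧ 2 ≤ j₂ ∧ j₂ + 2 ≤ u ∧ ∃ c : ℝ, 0 < c ∧ ∃ N₀ : ℕ, ∀ N : ℕ, N₀ ≤ N → (∀ j ∈ ({1, j₁ - 1, j₁, j₁ + 1, j₂ - 1, j₂, j₂ + 1} : Finset ℕ), c * (N : ℝ) / Real.log N ≤ ((((Finset.Icc 1 N).filter (fun m => (N : ℝ) ^ ((1 : ℝ) / u) <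 (Nat.minFac m : ℝ) ∧ ArithmeticFunction.cardFactors m = j)).card : ℕ) : ℝ)) ∧ (∀ j ∈ ({j₁, j₂} : Finset ℕ), (1 - ε) * ((((Finset.Icc 1 N).filter (fun m => (N : ℝ) ^ ((1 : ℝ) / u) < (Nat.minFac m : ℝ) ∧ ArithmeticFunction.cardFactors m = j)).card : ℕ) : ℝ) ^ 2 ≤ ((((Finset.Icc 1 N).filter (fun m => (N : ℝ) ^ ((1 : ℝ) / u) < (Nat.minFac m : ℝ) ∧ ArithmeticFunction.cardFactors m = j - 1)).card : ℕ) : ℝ) * ((((Finset.Icc 1 N).filter (fun m => (N : ℝ) ^ ((1 : ℝ) / u) < (Nat.minFac m : ℝ) ∧ ArithmeticFunction.cardFactors m = j + 1)).card : ℕ) : ℝ)) ∧ |∑ j ∈ Finset.Icc 1 u, (-1 : ℝ) ^ j * ((((Finset.Icc 1 N).filter (fun m => (N : ℝ) ^ ((1 : ℝ) / u) < (Nat.minFac m : ℝ) ∧ ArithmeticFunction.cardFactors m = j)).card : ℕ) : ℝ)| ≤ ε * ∑ j ∈ Finset.Icc 1 u, ((((Finset.Icc 1 N).filter (fun m =>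 (N : ℝ) ^ ((1 : ℝ) / u) < (Nat.minFac m : ℝ) ∧ ArithmeticFunction.cardFactors m = j)).card : ℕ) : ℝ)

/-- item stmt-Parity-14114 · support · rank 9 · closed · proved by Summit.Parity.GeneralizedHardyLittlewood.Theorems.HyperbolicityClipsParity_proof (prover) · by planner
sources: BorceaBranden2009, Wagner2011, HardyLittlewood1923, card:log-concavity-kills-parity
[support] (the clipping lemma, provable now; proof sketch follows, all constants chosen in the order
ε → ε₁ → δ → u → c → δ′ → N₀) CellParityLaw → FibreHyperbolicity → ModelCellFacts →
PrimeCellsRelative. Given t, L, ε: if archFactor·singularProduct < ε₁N the claim is trivial from the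
law (|θ_S| ≤ 2, A₁(N) ≤ 3N/log N). Otherwise fix a coordinate i and frozen w ∈ (0,1]^{t−1}; the
fibre polynomial has non-negative coefficients p_m = M a_m(α(w) + (−1)^{m+1}β(w)) + E_m with a_m =
A_m(N)/N, α ± β ≥ −o(1), |E_m| ≤ εu^{t−1}∏w_k N/log^t N; Newton's inequality p_m² ≥ p_{m−1}p_{m+1}
(real-rooted, non-negative coefficients) at the odd bulk index j₁ and the even one j₂, with margins
(1−δ)a_m² ≤ a_{m−1}a_{m+1}, gives |β(w)| ≤ δ'·∏_{k≠i} F_N(w_k) with F_N(w) = Σ_m a_m w^m; dividing,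
the multilinear form Σ_{S∋i} θ_S ∏_{k∈S∖i} ρ(w_k), ρ = F̃_N/F_N ∈ [−1,1], is ≤ δ' in absolute value
at the nodes ρ → 1 (w → 0⁺) and ρ(1) = O(ε) (parity balance), so interpolation on {ρ(1), 1}^{t−1}
bounds every θ_S, S ∋ i, by O_t(δ'); over all i, |Θ(1,…,1) − 1| = O_t(δ') and the prime cell follows
with relative error. [difficulty: provable-now] -/
@[route_item "route-Parity-LeeYangFibres", crux]
def HyperbolicityClipsParity : Prop :=
  CellParityLaw → FibreHyperbolicity → ModelCellFacts → PrimeCellsRelative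

/-- item stmt-Parity-14115 · support · rank 9 · closed · proved by Summit.Parity.GeneralizedHardyLittlewood.Theorems.LeeYangFibresCells.cellsToRelativeDimOne_proof @ a5cb05c21ac7 (prover) · by planner
sources: GreenTao2010, MontgomeryVaughan2007, Literature.NumberTheory.LFunctions.primeCounting_isEquivalent
[support] (partial summation, provable now) PrimeCellsRelative → RelativeDimOne: prime powers and
primes ≤ N^{1/u} contribute O(t√N log^{t+1}N + tN^{1/u} log^t N); n with some 0 < ψ_i(n) ≤ N^{1−η}
lie in ≤ t intervals of length ≤ N^{1−η} (contribution ≤ tN^{1−η}log^t N); on the ≤ t+1 remaining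
convex pieces ∏_i log ψ_i(n) = (1 + O(tη + t log 2L/log N)) log^t N, PrimeCellsRelative applies
piecewise, (A₁(N) log N/N)^t → 1 by PNT (tree: LFunctions.primeCounting_isEquivalent_holds), and
archFactor is additive over the pieces up to tN^{1−η}·singularProduct ≤ tN^{1−η}(C log N)^t.
[difficulty: provable-now] -/
@[route_item "route-Parity-LeeYangFibres", crux]
def CellsToRelativeDimOne : Prop :=
  PrimeCellsRelative → RelativeDimOne

/-- item stmt-Parity-14116 · support · rank 9 · open · by planner
why it might fail: False iff RelativeDimOne holds while DimOne fails: the gap is the t ≥ 2 family with ∏_pβ_p ≍ (e^γ log log N)^{t−1} (primorial shifts; inhabited: Theorems/LeeYangFibresAbsoluteUpgradeHighMass), where relative o(1) misses absolute εN by that factor; HL-strength, Siegel-sensitive, no mechanism here.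
sources: GreenTao2010, Gallagher1976, MatomakiMerikoski2023, Summits/Parity/GeneralizedHardyLittlewood/Theorems/LeeYangFibresAbsoluteUpgradeSlices.lean, Summits/Parity/GeneralizedHardyLittlewood/Theorems/LeeYangFibresAbsoluteUpgradeHighMass.lean, Summits/Parity/GeneralizedHardyLittlewood/Cruxes/AbsoluteUpgrade/STRATEGY-CENSUS.md
[support] (RESIDUAL — not addressed by this mechanism; filed so that `closes` decides the
sub-problem, D-0027 §2.1) RelativeDimOne → DimOne: upgrading relative accuracy ε·β_∞∏β_p to DimOne's
absolute εN on the systems with ∏_pβ_p(Ψ) ≍ (log log N)^{t−1} (shifts with many small prime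
factors). Fixed-degree hyperbolicity clips the parity amplitudes only to relative accuracy b(u);
beating sup_Ψ∏β_p would need u → ∞ with N together with the exponential decay of the model's
hyperbolicity threshold θ*(u) (gen-1 kit j000121: 0.175, 0.055, 0.020, 0.010, <0.005 at u = 4…8) —
recorded under NOT DECOMPOSED YET, not claimed. True if DimOne is; no mechanism here proves it.
[difficulty: open-problem] -/
@[route_item "route-Parity-LeeYangFibres"]
def AbsoluteUpgrade : Prop :=
  RelativeDimOne → DimOne

/-- item stmt-Parity-18105 · support · rank 9 · closed · proved by Summit.Parity.GeneralizedHardyLittlewood.Theorems.quantitativeClipping_proof @ 404590d1fddf (prover) · by planner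
sources: Summits/Parity/GeneralizedHardyLittlewood/Theorems/LeeYangFibresAbsoluteUpgradeDipReduction.lean, Summits/Parity/GeneralizedHardyLittlewood/Theorems/LeeYangFibresAbsoluteUpgradeDipDefs.lean, Greaves2001, Alladi1982, KowalskiNikeghbali2010, GreenTao2010
[support] (ROUTINE — already a theorem of the tree; the third hypothesis of `closes`)
CellParityLawSaving → FibreHyperbolicityAlong → DimOne: the quantitative clipping along u = U(N) =
max 4 ⌊√(log log N)/2⌋ — full real-rootedness of every fibre, read through the model pencil F_u(ζ) +
θF_u(−ζ) of the Buchstab–Dickman row, clips its odd Walsh amplitude below the pencil threshold,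
which decays faster than every power of u (MarginPoly, PROVED from the mod-Gamma disc asymptotic
ModGammaDisc and the explicit pencil zero PencilChainZero, all landed), (log log N)^{t−1} ≤
(2U+2)^{2t−2}, anatomy along the schedule (AnatomyAlong p102212), QuantClip (p114484), partial
summation with ∏_pβ_p ≤ (C log log N)^{t−1} (CellsToDimOne p100021); composed as
`Summit.Parity.GeneralizedHardyLittlewood.Cruxes.AbsoluteUpgrade.DipMarginRateExchange.dimOne_of_dipInputs`
(Theorems/LeeYangFibresAbsoluteUpgradeDipReduction, p114853; axioms
propext/Classical.choice/Quot.sound only). ONE-LINE PROOF for this item (planner Sketch.lean, lean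
check rc 0 — both crux statements are Iff.rfl-equal to the dip line's): `theorem
quantitativeClipping_proof : Summit.Parity.GeneralizedHardyLittlewood.Theses.LeeYangFibres.Quanti -/
@[route_item "route-Parity-LeeYangFibres", crux]
def QuantitativeClipping : Prop :=
  CellParityLawSaving → FibreHyperbolicityAlong → DimOne

-- earlier Assembly (stmt-Parity-14117, replaced 2026-08-16T04:03:47Z -> stmt-Parity-14612): retired by None — CellParityLaw → FibreHyperbolicity → ModelCellFacts → HyperbolicityClipsParity → CellsToRelativeDimOne → AbsoluteUpgrade → FibrationLemma → GeneralizedHardyLittlewood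
/-- item stmt-Parity-14612 · assembly · rank 1 · closed · proved by Summit.Parity.GeneralizedHardyLittlewood.Theorems.leeYangFibres_assembly (prover) · by planner
sources: GreenTao2010, BombieriAsymptoticSieve1976, card:lee-yang-circle-prime-factors
[assembly] (restated 2026-08-16 for ground — the former pure-logic composition CellParityLaw → … →
FibrationLemma → GeneralizedHardyLittlewood was trivially provable, `ground.trivial: intros; aesop`)
The two cruxes and the one declared residual imply the Statement: CellParityLaw → FibreHyperbolicity
→ AbsoluteUpgrade → GeneralizedHardyLittlewood. Proof obligation = exactly the route's four
provable-now supports, composed as in `closes`: `fun hL hH hU => FibrationLemma_pf (hU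
(CellsToRelativeDimOne_pf (HyperbolicityClipsParity_pf hL hH ModelCellFacts_pf)))` — i.e.
ModelCellFacts (rough-integer Ω-cell anatomy, Alladi1982 / Tenenbaum2015 III.6),
HyperbolicityClipsParity (Newton + multilinear interpolation clipping lemma), CellsToRelativeDimOne
(partial summation + PNT) and FibrationLemma (GreenTao2010 App. A fibration). Closing it certifies
that the mechanism's deterministic glue is formalised; it is an item, not a hypothesis of `closes`
(verified in the planner's Sketch.lean: elaborates, gate ground battery flags = [], and the supports
compose to it). -/
@[route_item "route-Parity-LeeYangFibres"]
def Assembly : Prop :=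
  CellParityLaw → FibreHyperbolicity → AbsoluteUpgrade → GeneralizedHardyLittlewood

/-! D-0027 §2.1 — DECIDING THEOREM (planner-authored via `route open/edit --closes-file`; by planner-rbadge-Parity-LeeYangFibres-4f69541d-g3-0 2026-08-17T08:26:23Z):
its hypotheses are this route's items and its conclusion the sub-problem Statement (glue_lint), and it elaborates with this file. -/

/-- D-0027 §2.1 deciding theorem of route LeeYangFibres — RE-CUT by the route-repair (hides-summit, rbadge g3)
seat 2026-08-17 to the QUANTITATIVE mechanism. Hypotheses: the two ranked, LOAD-BEARING cruxes
`CellParityLawSaving` (3: the multi-character Bombieri law for the joint rough cells along the schedule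
`u = U(N) = max 4 ⌊√(log log N)/2⌋` with a `(log N)^{-δ}` saving) and `FibreHyperbolicityAlong` (2: every fibre
of the joint rough-cell polynomial at `u = U(N)` is real-rooted on bodies of singular mass `≥ ηN`), and two
ROUTINE supports that are already theorems of the tree: `QuantitativeClipping : CellParityLawSaving →
FibreHyperbolicityAlong → DimOne` (= `Cruxes.AbsoluteUpgrade.DipMarginRateExchange.dimOne_of_dipInputs`,
p114853 — MarginPoly / ModGammaDisc / PencilChainZero / AnatomyAlong / QuantClip / CellsToDimOne all landed;
both crux statements are `Iff.rfl`-equal to the dip line's, so `theorem quantitativeClipping_proof :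
QuantitativeClipping := fun hL hH => …dimOne_of_dipInputs hL hH` closes the item in one line; that module
imports this Theses file, hence a hypothesis, not an import) and `FibrationLemma : DimOne →
GeneralizedHardyLittlewood` (stmt-Parity-0822, PROVED 2026-08-16 by `Theorems.leeYangFibres_fibrationLemma`,
Theses-free core `FibrationGlue.generalizedHardyLittlewood_of_dimOne`; admissible by class). The former cut
`closes hR hU hF := hF (hU hR)` through the complementary-sector crux `AbsoluteUpgrade := RelativeDimOne →
DimOne` is retired: that crux is kernel-checked `≡ DimOne ∨ ¬RelativeDimOne` (p121721) and every skeleton of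
it hides the summit (gate finding 2026-08-17; Cruxes/AbsoluteUpgrade/STRATEGY-CENSUS.md); it stays in the
file as a support (corollary: `absoluteUpgrade_of_dipInputs`). CRUX-ONLY END FORM (when the two supports have
`_holds`/proved links usable here): `closes hL hH := FibrationLemma_holds (QuantitativeClipping_holds hL hH)`.
Pure logic. -/
@[closes "route-Parity-LeeYangFibres"] theorem closes (hL : CellParityLawSaving) (hH : FibreHyperbolicityAlong) (hQ : QuantitativeClipping)
    (hF : FibrationLemma) : _root_.GeneralizedHardyLittlewood :=
  hF (hQ hL hH)

end Summit.Parity.GeneralizedHardyLittlewood.Theses.LeeYangFibres
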